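import Mathlib
import Literature.Analysis.ODE.VariationalEnclosureIntervalTest
import HarnessLib

/-!
# The C¹ high-order enclosure test for polynomial fields by natural interval extension

For a POLYNOMIAL vector field `p` the data of the `C¹` high-order enclosure (HOE) test are all
computable by interval evaluation of explicit polynomials: the Taylor coefficient maps
`Φ_j = taylorMap p j` are the evaluations of the polynomials `taylorPoly p j` produced by Moore's
recurrences (`LieSeriesTaylorCoefficients.lean`), their Jacobians `Φ_j' = ψ^[j](0, ·, Id)` are the
evaluations of the formal partial derivatives `∂_l (taylorPoly p j)_i`
(`hasFDerivAt_taylorMap`), and Moore's natural interval extension encloses the range of any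
polynomial over a box (`eval_mem_polyBox`, Moore 1979 Theorem 3.1 / Corollary 3.1).  Hence the
`C¹` rough-enclosure step of Walawska–Wilczak 2016 §2.1 — predict
`[ỹ] = ∑_{i≤m} [0,h]^i φ^[i](0,[x_k]) + [ε]`, `[Ṽ] = ∑_{i≤m} [0,h]^i ψ^[i](0,[x_k],Id) + [E]` and
"check simultaneously" `[0,h]^{m+1} φ^[m+1](0,[ỹ]) ⊂ [ε]` and
`[0,h]^{m+1} ψ^[m+1](0,[ỹ],Id)[Ṽ] ⊂ [E]` — becomes, for polynomial fields, TWO CONTAINMENTS OF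
COMPUTED INTERVAL OBJECTS with no analytic side condition at all.  This file proves that form,
by specialising the open-domain box-data theorem `variationalEnclosure_step_intervalTest_smoothOn_local`
(`VariationalEnclosureIntervalTest.lean`) to `Ω = ℝ^ι`, `f = evalVec p`, after identifying the
smooth-field Taylor data `smoothTaylorMap`, `smoothTaylorFDeriv` of a polynomial field with the
polynomial ones.

## Contents

* `contDiff_mvPolynomial_eval`, `contDiff_evalVec`, `contDiffOn_evalVec_top`, `fderiv_evalVec` —
  polynomial maps are `C^∞` with derivative the formal Jacobian `evalVecFDeriv`;
* `smoothTaylorMap_polynomial`, `smoothTaylorFDeriv_polynomial` — for `f = evalVec p` on `Ω = ⊤`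
  the flow Taylor coefficient maps of `SmoothFieldTaylorCoefficients.lean` ARE `taylorMap p k`, and
  their derivatives are `evalVecFDeriv (taylorPoly p k)` (both families satisfy `Φ_0 = id` and
  the Lie–Taylor recursion `Φ_k' · f = (k+1) Φ_{k+1}`, Moore 1979 (3.15)–(3.17));
* `jacPolyBox B q` — the natural interval extension of the formal Jacobian of a vector of
  polynomials (`(i, l) ↦ polyBox B (∂_l q_i)`), with `evalVecFDeriv_single_mem_jacPolyBox`
  (inclusion property, Moore's Corollary 3.1 entrywise) and `jacPolyBox_le_jacPolyBox`
  (isotonicity);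
* `variationalEnclosure_step_intervalTest_polynomial` — the `C¹` HOE step for `y' = p(y)`,
  `V' = Dp(y) ∘ V` from boxes `E_j ⊇ polyBoxVec W (taylorPoly p j)`, `V ⊇ polyBoxVec S (taylorPoly p K)`,
  interval matrices `EV_j ⊇ jacPolyBox W (taylorPoly p j)`, `AK ⊇ jacPolyBox S (taylorPoly p K)`,
  `NN ⊇ AK · VV` (outward-rounded machine evaluations qualify, by isotonicity) and the two tests
  `∑_{j<K} T^j·E_j + T^K·V ⊆ S`, `∑_{j<K} T^j·EV_j + T^K·NN ⊆ VV`;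
* `variationalEnclosure_step_naturalExtension_polynomial` — the same with ALL interval data
  computed exactly by natural extension: hypotheses = the two containments only;
* `hasFDerivWithinAt_flow_intervalTest_polynomial` — the derivative of the flow of a polynomial
  field within the box of initial conditions lies in `VV` and in `∑_{j<K} T'^j·EV_j + T'^K·NN`
  (`T' ∋ τ`; `T' = [h,h]` gives the `C¹`-Lohner matrix `J1 ∋ Dφ_h(x)`).

## References

* I. Walawska, D. Wilczak, *An implicit algorithm for validated enclosures of the solutions to
  variational equations for ODEs*, Appl. Math. Comput. 291 (2016) 303–322 (arXiv:1509.07388),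
  §1.2 (`ψ(t,x,V) = D_xφ(t,x)·V`, Taylor coefficients `φ^[i]`, `ψ^[i]`), §2.1 (the `C¹` HOE
  predictor and test). [WalawskaWilczak2016]
* P. Zgliczyński, *C¹ Lohner algorithm*, Found. Comput. Math. 2 (2002) 429–465. [Zgliczynski2002C1Lohner]
* R. E. Moore, *Methods and Applications of Interval Analysis*, SIAM 1979, §3.2 (3.4)–(3.5),
  §3.3 Theorem 3.1 / Corollary 3.1, §3.4 (3.13)–(3.17), §8.1 (8.9)–(8.10). [Moore1979]
* A. Neumaier, *Interval Methods for Systems of Equations*, Cambridge UP 1990, §3.1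
  Proposition 3.1.2 (6)–(7). [Neumaier1991]
* E. Hairer, C. Lubich, G. Wanner, *Geometric Numerical Integration*, §III.5.1 (5.1)–(5.8).
  [HairerWannerLubich2002]
-/

noncomputable section

open Set Metric Filter Topology TopologicalSpace NonemptyInterval

open scoped NNReal ContDiff

namespace Literature.Analysis.ODE

/-! ### Polynomial maps are smooth -/

section PolynomialSmooth

variable {ι : Type*} [Fintype ι]

/-- A real polynomial function of finitely many variables is `C^n` for every `n`
(constants, coordinates, sums and products of smooth functions are smooth).
[cite: HairerWannerLubich2002, §III.5.1 eq. (5.2)] -/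
theorem contDiff_mvPolynomial_eval (q : MvPolynomial ι ℝ) {n : WithTop ℕ∞} :
    ContDiff ℝ n fun x : ι → ℝ => MvPolynomial.eval x q := by
  induction q using MvPolynomial.induction_on with
  | C a => simpa using contDiff_const
  | add p q hp hq => simpa using hp.add hq
  | mul_X p i hp => simpa using hp.mul (contDiff_apply ℝ ℝ i)

/-- A polynomial vector field `evalVec q` is `C^n` for every `n`.
[cite: HairerWannerLubich2002, §III.5.1 eqs. (5.1)–(5.2)] -/
theorem contDiff_evalVec (q : ι → MvPolynomial ι ℝ) {n : WithTop ℕ∞} : ContDiff ℝ n (evalVec q) :=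
  contDiff_pi.2 fun i => contDiff_mvPolynomial_eval (q i)

/-- A polynomial vector field is `C^∞` on the whole space, viewed as the open set `⊤` — the
hypothesis `hf` of the smooth-field enclosure theorems, for `Ω = ℝ^ι`.
[cite: HairerWannerLubich2002, §III.5.1 eqs. (5.1)–(5.2)] -/
theorem contDiffOn_evalVec_top (q : ι → MvPolynomial ι ℝ) :
    ContDiffOn ℝ ∞ (evalVec q) ((⊤ : Opens (ι → ℝ)) : Set (ι → ℝ)) :=
  (contDiff_evalVec q).contDiffOn

/-- The Fréchet derivative of a polynomial vector field is its formal Jacobian,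
`fderiv (evalVec q) = evalVecFDeriv q`. [cite: HairerWannerLubich2002, §III.5.1 eq. (5.2)] -/
theorem fderiv_evalVec (q : ι → MvPolynomial ι ℝ) : fderiv ℝ (evalVec q) = evalVecFDeriv q :=
  funext fun x => (hasFDerivAt_evalVec q x).fderiv

/-- **The smooth-field Taylor coefficient maps of a polynomial field are the polynomial ones**:
for `f = evalVec p` on `Ω = ℝ^ι`, `smoothTaylorMap _ k = taylorMap p k` — both families satisfy
`Φ_0 = id` and the Lie–Taylor recursion `Φ_k'(x) f(x) = (k+1) Φ_{k+1}(x)` (Moore 1979 (3.15),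
(3.17)), which determines them. [cite: Moore1979, §3.4 eqs. (3.13)–(3.17)]
[cite: HairerWannerLubich2002, §III.5.1 eqs. (5.6)–(5.8)] -/
theorem smoothTaylorMap_polynomial (p : ι → MvPolynomial ι ℝ) (k : ℕ) :
    smoothTaylorMap (contDiffOn_evalVec_top p) k = taylorMap p k := by
  induction k with
  | zero =>
    funext x
    rw [smoothTaylorMap_zero, taylorMap_zero]
  | succ k ih =>
    funext x
    have hx : x ∈ ((⊤ : Opens (ι → ℝ)) : Set (ι → ℝ)) := trivial
    have hD : smoothTaylorFDeriv (contDiffOn_evalVec_top p) k x =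
        evalVecFDeriv (taylorPoly p k) x :=
      (hasFDerivAt_smoothTaylorMap (contDiffOn_evalVec_top p) k hx).unique
        (by rw [ih]; exact hasFDerivAt_taylorMap p k x)
    have h1 := smoothTaylorFDeriv_apply_field (contDiffOn_evalVec_top p) k hx
    rw [hD, taylorMap_rec] at h1
    have hk : ((k : ℝ) + 1) ≠ 0 := by positivity
    exact ((smul_right_inj hk).1 h1).symm

/-- **The Jacobians of the Taylor coefficient maps of a polynomial field are the formal
Jacobians of the Taylor coefficient polynomials**: `smoothTaylorFDeriv _ k x =
evalVecFDeriv (taylorPoly p k) x` (`ψ^[k](0, x, Id) = D_x φ^[k](0, x)`, computed by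
differentiating Moore's recurrences). [cite: WalawskaWilczak2016, §1.2 (ψ = D_xφ·V, Taylor coefficients φ^[i], ψ^[i])]
[cite: Moore1979, §3.4 eqs. (3.13)–(3.17)] -/
theorem smoothTaylorFDeriv_polynomial (p : ι → MvPolynomial ι ℝ) (k : ℕ) (x : ι → ℝ) :
    smoothTaylorFDeriv (contDiffOn_evalVec_top p) k x = evalVecFDeriv (taylorPoly p k) x :=
  (hasFDerivAt_smoothTaylorMap (contDiffOn_evalVec_top p) k
    (show x ∈ ((⊤ : Opens (ι → ℝ)) : Set (ι → ℝ)) from trivial)).unique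
    (by rw [smoothTaylorMap_polynomial]; exact hasFDerivAt_taylorMap p k x)

end PolynomialSmooth

/-! ### Natural interval extension of the formal Jacobian -/

section Jacobian

variable {ι : Type*}

/-- The **natural interval extension of the formal Jacobian** of a vector of polynomials over
the box `B`: the interval matrix `(i, l) ↦ polyBox B (∂_l q_i)` (interval evaluation of the
partial-derivative polynomials; for `q = taylorPoly p j` this is the machine's
`ψ^[j](0, [B], Id)`). [cite: Moore1979, §3.3 (natural interval extension)]
[cite: WalawskaWilczak2016, §2.1 (C¹ high-order enclosure)] -/
def jacPolyBox (B : ι → NonemptyInterval ℝ) (q : ι → MvPolynomial ι ℝ) :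
    ι → ι → NonemptyInterval ℝ :=
  fun i l => polyBox B (MvPolynomial.pderiv l (q i))

/-- Inclusion isotonicity of the Jacobian extension. [cite: Moore1979, §3.2 eq. (3.4)] -/
theorem jacPolyBox_le_jacPolyBox {B B' : ι → NonemptyInterval ℝ} (h : B ≤ B')
    (q : ι → MvPolynomial ι ℝ) : jacPolyBox B q ≤ jacPolyBox B' q :=
  fun i l => polyBox_le_polyBox h (MvPolynomial.pderiv l (q i))

variable [Fintype ι] [DecidableEq ι]

/-- The entries of the formal Jacobian: `(Dq(x) e_l)_i = (∂_l q_i)(x)`.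
[cite: HairerWannerLubich2002, §III.5.1 eq. (5.2)] -/
theorem evalVecFDeriv_single (q : ι → MvPolynomial ι ℝ) (x : ι → ℝ) (i l : ι) :
    evalVecFDeriv q x (Pi.single l 1) i = MvPolynomial.eval x (MvPolynomial.pderiv l (q i)) := by
  rw [evalVecFDeriv_apply, Finset.sum_eq_single l]
  · simp
  · intro j _ hjl
    simp [hjl]
  · intro hl
    exact absurd (Finset.mem_univ l) hl

/-- **Inclusion property of the Jacobian extension** (Moore's Corollary 3.1, entrywise):
`x ∈ B ⇒ (Dq(x))_{il} ∈ (jacPolyBox B q)_{il}`. [cite: Moore1979, §3.3 Theorem 3.1 and Corollary 3.1] -/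
theorem evalVecFDeriv_single_mem_jacPolyBox {B : ι → NonemptyInterval ℝ}
    (q : ι → MvPolynomial ι ℝ) {x : ι → ℝ} (hx : x ∈ boxSet B) (i l : ι) :
    evalVecFDeriv q x (Pi.single l 1) i ∈ jacPolyBox B q i l := by
  rw [evalVecFDeriv_single]
  exact eval_mem_polyBox _ hx

end Jacobian

/-! ### The C¹ HOE step for polynomial fields from computed interval data -/

section Step

variable {ι : Type*} [Fintype ι] [DecidableEq ι]

omit [Fintype ι] [DecidableEq ι] in
/-- Membership is transported along containment of interval matrices (entrywise reading of
`matBoxSet_mono`). [folklore] -/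
private theorem mem_of_imat_le {A A' : ι → ι → NonemptyInterval ℝ} (h : A ≤ A') {a : ι → ι → ℝ}
    (ha : ∀ i l, a i l ∈ A i l) : ∀ i l, a i l ∈ A' i l :=
  (mem_matBoxSet_iff (A := A')).1 (matBoxSet_mono h ((mem_matBoxSet_iff (A := A)).2 ha))

/-- **`C¹` high-order enclosure step for a polynomial field, interval form**
(Walawska–Wilczak 2016 §2.1 for `y' = p(y)`; Zgliczyński 2002).  Let `p` be a polynomial field,
`K ≥ 1`, `h ≥ 0`, `T ⊇ [0, h]`, boxes `W` (initial conditions), `S` (a-priori enclosure),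
`E_j ⊇ polyBoxVec W (taylorPoly p j)` (`j < K`), `V ⊇ polyBoxVec S (taylorPoly p K)`, interval
matrices `EV_j ⊇ jacPolyBox W (taylorPoly p j)` (`j < K`), `AK ⊇ jacPolyBox S (taylorPoly p K)`,
`VV`, `NN ⊇ AK · VV` — containing the natural interval extensions, as outward-rounded machine
evaluations do — and suppose the two tests `∑_{j<K} T^j·E_j + T^K·V ⊆ S` and
`∑_{j<K} T^j·EV_j + T^K·NN ⊆ VV` hold.  Then for every `x ∈ W` the variational system
`y' = p(y)`, `V' = Dp(y) ∘ V`, `y(0) = x`, `V(0) = Id` has a solution on `[0, h]`, and EVERY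
solution pair `(z, J)` satisfies for all `t ∈ [0, h]`: `z t ∈ S`,
`z t = ∑_{j<K} t^j Φ_j(x) + t^K v` (`v ∈ V`, `Φ_j = taylorMap p j`), `J t ∈ VV` and
`J t = ∑_{j<K} t^j DΦ_j(x) + t^K N` (`N ∈ NN`, `DΦ_j(x) = evalVecFDeriv (taylorPoly p j) x`),
entrywise. [cite: WalawskaWilczak2016, §2.1 (C¹ high-order enclosure) and §2.2 Lemma 2]
[cite: Moore1979, §3.2 eqs. (3.4)–(3.5) and §8.1 eqs. (8.9)–(8.10)]
[cite: Neumaier1991, §3.1 Proposition 3.1.2 (6)–(7)] -/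
theorem variationalEnclosure_step_intervalTest_polynomial (p : ι → MvPolynomial ι ℝ) {K : ℕ}
    (hK : 0 < K) {h : ℝ} (hh : 0 ≤ h) {T : NonemptyInterval ℝ} (hT : ∀ t ∈ Icc 0 h, t ∈ T)
    (W S V : ι → NonemptyInterval ℝ) (E : ℕ → ι → NonemptyInterval ℝ)
    (EV : ℕ → ι → ι → NonemptyInterval ℝ) (AK VV NN : ι → ι → NonemptyInterval ℝ)
    (hE : ∀ j < K, polyBoxVec W (taylorPoly p j) ≤ E j) (hV : polyBoxVec S (taylorPoly p K) ≤ V)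
    (htest : hoeBox T E V K ≤ S) (hEV : ∀ j < K, jacPolyBox W (taylorPoly p j) ≤ EV j)
    (hAK : jacPolyBox S (taylorPoly p K) ≤ AK) (hNN : imatmul AK VV ≤ NN)
    (htestV : hoeMatBox T EV NN K ≤ VV) {x : ι → ℝ} (hx : x ∈ boxSet W) :
    (∃ y : ℝ → ι → ℝ, ∃ V' : ℝ → (ι → ℝ) →L[ℝ] (ι → ℝ), y 0 = x ∧ V' 0 = 1 ∧
      (∀ t ∈ Icc 0 h, HasDerivWithinAt y (evalVec p (y t)) (Icc 0 h) t) ∧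
      ∀ t ∈ Icc 0 h, HasDerivWithinAt V' ((evalVecFDeriv p (y t)).comp (V' t)) (Icc 0 h) t) ∧
    ∀ (z : ℝ → ι → ℝ) (J : ℝ → (ι → ℝ) →L[ℝ] (ι → ℝ)), z 0 = x → J 0 = 1 →
      (∀ t ∈ Icc 0 h, HasDerivWithinAt z (evalVec p (z t)) (Icc 0 h) t) →
      (∀ t ∈ Icc 0 h, HasDerivWithinAt J ((evalVecFDeriv p (z t)).comp (J t)) (Icc 0 h) t) →
      ∀ t ∈ Icc 0 h,
        (z t ∈ boxSet S ∧ ∃ v ∈ boxSet V,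
          z t = (∑ j ∈ Finset.range K, t ^ j • taylorMap p j x) + t ^ K • v) ∧
        (∀ i l, J t (Pi.single l 1) i ∈ VV i l) ∧
        ∃ N : (ι → ℝ) →L[ℝ] (ι → ℝ), (∀ i l, N (Pi.single l 1) i ∈ NN i l) ∧
          J t = (∑ j ∈ Finset.range K, t ^ j • evalVecFDeriv (taylorPoly p j) x) + t ^ K • N := by
  have hf := contDiffOn_evalVec_top p
  have hE' : ∀ j < K, MapsTo (smoothTaylorMap hf j) (boxSet W) (boxSet (E j)) := fun j hj => by
    rw [smoothTaylorMap_polynomial]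
    exact (mapsTo_taylorMap_polyBoxVec p j W).mono_right (boxSet_mono (hE j hj))
  have hV' : MapsTo (smoothTaylorMap hf K) (boxSet S) (boxSet V) := by
    rw [smoothTaylorMap_polynomial]
    exact (mapsTo_taylorMap_polyBoxVec p K S).mono_right (boxSet_mono hV)
  have hEV' : ∀ j < K, ∀ x ∈ boxSet W, ∀ i l,
      smoothTaylorFDeriv hf j x (Pi.single l 1) i ∈ EV j i l := fun j hj x hx => by
    simp_rw [smoothTaylorFDeriv_polynomial]
    exact mem_of_imat_le (hEV j hj) (evalVecFDeriv_single_mem_jacPolyBox (taylorPoly p j) hx)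
  have hAK' : ∀ z ∈ boxSet S, ∀ i l, smoothTaylorFDeriv hf K z (Pi.single l 1) i ∈ AK i l :=
    fun z hz => by
    simp_rw [smoothTaylorFDeriv_polynomial]
    exact mem_of_imat_le hAK (evalVecFDeriv_single_mem_jacPolyBox (taylorPoly p K) hz)
  have hmain := variationalEnclosure_step_intervalTest_smoothOn_local hf hK hh hT W S V E EV AK
    VV NN (fun _ _ => trivial) hE' hV' htest hEV' hAK' hNN htestV hx
  simpa only [smoothTaylorMap_polynomial, smoothTaylorFDeriv_polynomial, fderiv_evalVec]
    using hmain

/-- **`C¹` high-order enclosure step for a polynomial field with ALL interval data computed by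
natural interval extension** (exact real interval arithmetic): with
`E_j := polyBoxVec W (taylorPoly p j)`, `V := polyBoxVec S (taylorPoly p K)`,
`EV_j := jacPolyBox W (taylorPoly p j)`, `AK := jacPolyBox S (taylorPoly p K)`, `NN := AK · VV`,
the TWO containments `∑_{j<K} T^j·E_j + T^K·V ⊆ S` and `∑_{j<K} T^j·EV_j + T^K·(AK·VV) ⊆ VV`
— Walawska–Wilczak's "check simultaneously (HOE) and (C¹-HOE)" — yield existence of the
variational pair from `(x, Id)` for every `x ∈ W` and the enclosure of EVERY solution pair: state
in `S` and in the Taylor tube, Jacobian in `VV` with the Taylor representation and remainder in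
`AK · VV`, entrywise. [cite: WalawskaWilczak2016, §2.1 (C¹ high-order enclosure) and §2.2 Lemma 2]
[cite: Moore1979, §3.3 Corollary 3.1 and §8.1 eqs. (8.9)–(8.10)]
[cite: Neumaier1991, §3.1 Proposition 3.1.2 (6)] -/
theorem variationalEnclosure_step_naturalExtension_polynomial (p : ι → MvPolynomial ι ℝ)
    {K : ℕ} (hK : 0 < K) {h : ℝ} (hh : 0 ≤ h) {T : NonemptyInterval ℝ}
    (hT : ∀ t ∈ Icc 0 h, t ∈ T) (W S : ι → NonemptyInterval ℝ) (VV : ι → ι → NonemptyInterval ℝ)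
    (htest : hoeBox T (fun j => polyBoxVec W (taylorPoly p j)) (polyBoxVec S (taylorPoly p K)) K
      ≤ S)
    (htestV : hoeMatBox T (fun j => jacPolyBox W (taylorPoly p j))
      (imatmul (jacPolyBox S (taylorPoly p K)) VV) K ≤ VV)
    {x : ι → ℝ} (hx : x ∈ boxSet W) :
    (∃ y : ℝ → ι → ℝ, ∃ V' : ℝ → (ι → ℝ) →L[ℝ] (ι → ℝ), y 0 = x ∧ V' 0 = 1 ∧
      (∀ t ∈ Icc 0 h, HasDerivWithinAt y (evalVec p (y t)) (Icc 0 h) t) ∧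
      ∀ t ∈ Icc 0 h, HasDerivWithinAt V' ((evalVecFDeriv p (y t)).comp (V' t)) (Icc 0 h) t) ∧
    ∀ (z : ℝ → ι → ℝ) (J : ℝ → (ι → ℝ) →L[ℝ] (ι → ℝ)), z 0 = x → J 0 = 1 →
      (∀ t ∈ Icc 0 h, HasDerivWithinAt z (evalVec p (z t)) (Icc 0 h) t) →
      (∀ t ∈ Icc 0 h, HasDerivWithinAt J ((evalVecFDeriv p (z t)).comp (J t)) (Icc 0 h) t) →
      ∀ t ∈ Icc 0 h,
        (z t ∈ boxSet S ∧ ∃ v ∈ boxSet (polyBoxVec S (taylorPoly p K)),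
          z t = (∑ j ∈ Finset.range K, t ^ j • taylorMap p j x) + t ^ K • v) ∧
        (∀ i l, J t (Pi.single l 1) i ∈ VV i l) ∧
        ∃ N : (ι → ℝ) →L[ℝ] (ι → ℝ),
          (∀ i l, N (Pi.single l 1) i ∈ imatmul (jacPolyBox S (taylorPoly p K)) VV i l) ∧
          J t = (∑ j ∈ Finset.range K, t ^ j • evalVecFDeriv (taylorPoly p j) x) + t ^ K • N :=
  variationalEnclosure_step_intervalTest_polynomial p hK hh hT W S (polyBoxVec S (taylorPoly p K))
    (fun j => polyBoxVec W (taylorPoly p j)) (fun j => jacPolyBox W (taylorPoly p j))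
    (jacPolyBox S (taylorPoly p K)) VV (imatmul (jacPolyBox S (taylorPoly p K)) VV)
    (fun _ _ => le_rfl) le_rfl htest (fun _ _ => le_rfl) le_rfl le_rfl htestV hx

/-- **The derivative of the flow of a polynomial field from the interval tests**
(Walawska–Wilczak 2016 §1.2 `ψ(t,x,Id) = D_xφ(t,x)`, §2.1; Zgliczyński 2002).  Under the
hypotheses of `variationalEnclosure_step_intervalTest_polynomial`, with `boxSet S` a set of unique
differentiability (e.g. `uniqueDiffOn_boxSet`), for ANY family `u` of solutions of `y' = p(y)` on
`[0, h]` from the points of `W` with values in `S`, every `x ∈ W`, `τ ∈ [0, h]` and any `T' ∋ τ`: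
the flow map `x' ↦ u x' τ` has within `boxSet W` at `x` a derivative `J` with entries in `VV` and
in `∑_{j<K} T'^j·EV_j + T'^K·NN`, and `J = ∑_{j<K} τ^j DΦ_j(x) + τ^K N`, `N ∈ NN`.
[cite: WalawskaWilczak2016, §1.2 (ψ = D_xφ·V) and §2.1 (C¹ high-order enclosure)]
[cite: Moore1979, §3.2 eqs. (3.4)–(3.5) and §8.1 eq. (8.10)] -/
theorem hasFDerivWithinAt_flow_intervalTest_polynomial (p : ι → MvPolynomial ι ℝ) {K : ℕ}
    (hK : 0 < K) {h : ℝ} (hh : 0 ≤ h) {T : NonemptyInterval ℝ} (hT : ∀ t ∈ Icc 0 h, t ∈ T)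
    (W S V : ι → NonemptyInterval ℝ) (E : ℕ → ι → NonemptyInterval ℝ)
    (EV : ℕ → ι → ι → NonemptyInterval ℝ) (AK VV NN : ι → ι → NonemptyInterval ℝ)
    (hSu : UniqueDiffOn ℝ (boxSet S))
    (hE : ∀ j < K, polyBoxVec W (taylorPoly p j) ≤ E j) (hV : polyBoxVec S (taylorPoly p K) ≤ V)
    (htest : hoeBox T E V K ≤ S) (hEV : ∀ j < K, jacPolyBox W (taylorPoly p j) ≤ EV j)
    (hAK : jacPolyBox S (taylorPoly p K) ≤ AK) (hNN : imatmul AK VV ≤ NN)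
    (htestV : hoeMatBox T EV NN K ≤ VV)
    {u : (ι → ℝ) → ℝ → ι → ℝ} (hu : IsSolutionFamily (evalVec p) (boxSet S) (boxSet W) h u)
    {x : ι → ℝ} (hx : x ∈ boxSet W) {τ : ℝ} (hτ : τ ∈ Icc 0 h) {T' : NonemptyInterval ℝ}
    (hτT' : τ ∈ T') :
    ∃ J : (ι → ℝ) →L[ℝ] (ι → ℝ), HasFDerivWithinAt (fun x' => u x' τ) J (boxSet W) x ∧
      (∀ i l, J (Pi.single l 1) i ∈ VV i l) ∧
      (∀ i l, J (Pi.single l 1) i ∈ hoeMatBox T' EV NN K i l) ∧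
      ∃ N : (ι → ℝ) →L[ℝ] (ι → ℝ), (∀ i l, N (Pi.single l 1) i ∈ NN i l) ∧
        J = (∑ j ∈ Finset.range K, τ ^ j • evalVecFDeriv (taylorPoly p j) x) + τ ^ K • N := by
  have hf := contDiffOn_evalVec_top p
  have hE' : ∀ j < K, MapsTo (smoothTaylorMap hf j) (boxSet W) (boxSet (E j)) := fun j hj => by
    rw [smoothTaylorMap_polynomial]
    exact (mapsTo_taylorMap_polyBoxVec p j W).mono_right (boxSet_mono (hE j hj))
  have hV' : MapsTo (smoothTaylorMap hf K) (boxSet S) (boxSet V) := by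
    rw [smoothTaylorMap_polynomial]
    exact (mapsTo_taylorMap_polyBoxVec p K S).mono_right (boxSet_mono hV)
  have hEV' : ∀ j < K, ∀ x ∈ boxSet W, ∀ i l,
      smoothTaylorFDeriv hf j x (Pi.single l 1) i ∈ EV j i l := fun j hj x hx => by
    simp_rw [smoothTaylorFDeriv_polynomial]
    exact mem_of_imat_le (hEV j hj) (evalVecFDeriv_single_mem_jacPolyBox (taylorPoly p j) hx)
  have hAK' : ∀ z ∈ boxSet S, ∀ i l, smoothTaylorFDeriv hf K z (Pi.single l 1) i ∈ AK i l :=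
    fun z hz => by
    simp_rw [smoothTaylorFDeriv_polynomial]
    exact mem_of_imat_le hAK (evalVecFDeriv_single_mem_jacPolyBox (taylorPoly p K) hz)
  have hmain := hasFDerivWithinAt_flow_intervalTest_smoothOn_local hf hK hh hT W S V E EV AK VV
    NN (fun _ _ => trivial) hSu hE' hV' htest hEV' hAK' hNN htestV hu hx hτ hτT'
  simpa only [smoothTaylorFDeriv_polynomial] using hmain

end Step

end Literature.Analysis.ODE

end
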